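import Summits.CriticalPhenomena.PercolationContinuityZ3.Theorems.PercNearOneGluingNoHeavyLowerTailClubPsiEventAllWeights
import Summits.CriticalPhenomena.PercolationContinuityZ3.Theorems.PercNearOneGluingNoHeavyLowerTailAnchoredRegimeII
import Summits.CriticalPhenomena.PercolationContinuityZ3.Theorems.PercNearOneGluingNoHeavyLowerTailFaceRegimeIExchange
import HarnessLib

/-!
# `NoHeavyLowerTail` (stmt-CriticalPhenomena-4575) — regime I of the `2 + (any law)` kernel FULLY ANCHORED: rankings in `K` / `K_u` only,
# no per-atom hypothesis (the quantitative glued Question 9 "CLUB", `ClubPsi.clubEvent`, supplies every atom — hard core included)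

Support file (prover `prim-cplus-coupling`, gen 17, for the lemma factory `prim-lf-3`; `--supports stmt-CriticalPhenomena-4575`).
No definitions, no named facts, no sorries.  Memos: `run/shared/lean/prim/prim-cplus-coupling/A5-COUPLING-gen17.md`,
`run/shared/lean/prim/prim-lf-3/LF3-BETA-R.md` §18c–d, §19.

Regime I of the formal face (memo LF3-BETA-R §16a/§17): the witness `j` is at most as connected to `b` as the `K`-weaker port `c` in the
mixture `K_u = (1−u)·K + u·K[cd↦1]` (`hjcu`).  `face_regimeI_of_exchange` / `kernel_twoPlusStar_regimeI_of_exchange` (lf-3 gen 15) carry,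
at every nonempty atom `Y ⊆ Q`, the EXCHANGE INEQUALITY `μ(jb) − μ(s₀b) ≤ μ((cb ∪ db), s₀ ≁ b,c,d,j) − μ(s₀b, c↮b, d↮b, (jc ∪ jd))` in
`K_u/Y` as the hypothesis `hexI`; it was discharged so far only outside the "hard core" (`spectatorExchange_atMostOneBelow`).  With the tree
theorem `ClubPsi.clubEvent` (CLUB(c), G-form, every weight vector: for an observer SET `N ∌ b` and relays `x, y, z` with `z` the least
`b`-reliable IN THE GRAPH ITSELF, `μ({z↔b} ∪ ({N↔z} ∩ {N↔b})) ≤ μ({N↔b} ∩ {N↔{x,y,z}}) + μ({x↔b} ∩ {N ↮ b,x,y,z})`) every atom follows from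
the `K_u`-rankings `j ≤ c ≤ d` alone:

* `gluedClub_row` — `clubEvent` rewritten in the glued graph `glue_Y w` along `ω ↦ ω ∪ clique(Y)` (as `gluedQ9_row`): for `s₀ ∈ Y ∌ b`,
  distinct relays `c, d, j ≠ b` with `μ_w(jb) ≤ μ_w(cb)`, `μ_w(jb) ≤ μ_w(db)`:
  `μ_{glue_Y w}(jb) ≤ μ_{glue_Y w}(s₀b ∩ U) + μ_{glue_Y w}(cb ∩ E)`, `U = {s₀↔d} ∪ {s₀↔j} ∪ {s₀↔c}`, `E = {s₀ ↮ b,c,d,j}` — the isolation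
  bound of `spectatorExchange_of_isolationBound` with `w = j`;
* `exchangeI_of_unglued_ranking` — the regime-I exchange inequality at EVERY block `Y ∌ b, c` and every `s₀ ∈ Y`, in the mixture
  `K_u/Y = (1−u)·glue_Y w + u·glue_Y w[cd↦1]`, from `j ≤ c`, `j ≤ d` in `K_u` (`gluedClub_row` for the raised graph, `glue_modifyPair_comm`,
  `real_raisePair_eq_mix`, `spectatorExchange_of_isolationBound`);
* `face_regimeI_anchored`, `twoPlusLaw_regimeI_anchored` — the gen-15 socket theorems with `hexI` discharged: hypotheses `hle` (c ≤ d in `K`),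
  `hjcu` (j ≤ c in `K_u`), the row(s) of `c` (, `d`), `q`, and NOTHING per atom.
The observer-level theorems (`kernel_twoPlusStar_regimeI_anchored`, and regimes I ∪ II merged: `kernel_twoPlusStar_portRow_anchored`) are in the
companion file `…KernelTwoPlusStarAnchored`; with regimes B, C, D (lf-3 gen 7/11) the whole `2 + m` kernel is then unconditional
(memo LF3-BETA-R §19 table, last open row).
[cite: KozmaNitzan2024, Question 9 (p. 36), Question 7 (p. 36), (41) (p. 36), Thm. 4–5 and Lemma 5 (pp. 12–14), (9) (pp. 9–10)]
-/

namespace Summit.CriticalPhenomena.PercolationContinuityZ3.Theorems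

open MeasureTheory Set ProbabilityTheory
open Literature.Probability.LatticeModels
open Literature.Probability.Percolation

noncomputable section
open Classical

namespace UpsetExchange

variable {n : ℕ}

/-- **The glued CLUB row.**  For a block `Y ∌ b` with `s₀ ∈ Y` and distinct relays `c, d, j ≠ b` with `μ_w(jb) ≤ μ_w(cb)`,
`μ_w(jb) ≤ μ_w(db)` (rankings in the unglued graph `w`): in `glue_Y w`,
`μ(jb) ≤ μ(s₀b ∩ U) + μ(cb ∩ {s₀ ↮ b,c,d,j})` for `U = {s₀↔d} ∪ {s₀↔j} ∪ {s₀↔c}`.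
(`ClubPsi.clubEvent` with `N = Y`, `(x,y,z) = (c,d,j)`, transported along `ω ↦ ω ∪ clique(Y)`.)
[cite: KozmaNitzan2024, Question 9 (p. 36), (9) (pp. 9–10)] -/
theorem gluedClub_row (w : Sym2 (Fin n) → unitInterval) (Y : Finset (Fin n)) (c d j b s₀ : Fin n)
    (hs₀ : s₀ ∈ Y) (hbY : b ∉ Y) (hcb : c ≠ b) (hdb : d ≠ b) (hjb : j ≠ b) (hcd : c ≠ d) (hcj : c ≠ j) (hdj : d ≠ j)
    (hjcw : (prodBernoulli w).real (openConn j b) ≤ (prodBernoulli w).real (openConn c b))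
    (hjdw : (prodBernoulli w).real (openConn j b) ≤ (prodBernoulli w).real (openConn d b)) :
    (prodBernoulli (fun e : Sym2 (Fin n) => if (∀ x ∈ e, x ∈ Y) ∧ ¬ e.IsDiag then 1 else w e)).real (openConn j b) ≤
      (prodBernoulli (fun e : Sym2 (Fin n) => if (∀ x ∈ e, x ∈ Y) ∧ ¬ e.IsDiag then 1 else w e)).real
          (openConn s₀ b ∩ (openConn s₀ d ∪ openConn s₀ j ∪ openConn s₀ c)) +
        (prodBernoulli (fun e : Sym2 (Fin n) => if (∀ x ∈ e, x ∈ Y) ∧ ¬ e.IsDiag then 1 else w e)).real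
          (openConn c b ∩ ((openConn s₀ b)ᶜ ∩ (openConn s₀ c)ᶜ ∩ (openConn s₀ d)ᶜ ∩ (openConn s₀ j)ᶜ)) := by
  set L : Sym2 (Fin n) → unitInterval := fun e => if (∀ x ∈ e, x ∈ Y) ∧ ¬ e.IsDiag then 1 else w e with hL
  set C : Set (Sym2 (Fin n)) := {e : Sym2 (Fin n) | (∀ x ∈ e, x ∈ Y) ∧ ¬ e.IsDiag} with hC
  -- CLUB in `w`, observer set `Y`, relays `(x,y,z) = (c,d,j)`
  have hbN : b ∉ (↑Y : Set (Fin n)) := fun h => hbY (Finset.mem_coe.1 h)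
  have key := ClubPsi.clubEvent w (↑Y : Set (Fin n)) b c d j hbN hcb hdb hjb (Ne.symm hcd) hdj hcj hjcw hjdw
  -- the gluing push-forward
  have hpush : ∀ G : Set (BondConfig (Fin n)), (prodBernoulli L).real G =
      (prodBernoulli w).real {ω : BondConfig (Fin n) | ((ω ∪ C : Set (Sym2 (Fin n))) : BondConfig (Fin n)) ∈ G} :=
    fun G => glueSet_pushforward w L C (fun e he => by simp only [hL, hC, mem_setOf_eq] at he ⊢; rw [if_pos he])
      (fun e he => by simp only [hL, hC, mem_setOf_eq] at he ⊢; rw [if_neg he]) G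
  -- reachability after gluing: from a block vertex, and between two outside vertices
  set NY : Fin n → Set (BondConfig (Fin n)) := fun v => {ω : BondConfig (Fin n) | ∃ m ∈ (↑Y : Set (Fin n)), (openGraph ω).Reachable m v}
    with hNY
  have hblock : ∀ (v : Fin n) (ω : BondConfig (Fin n)),
      (openGraph ((ω ∪ C : Set (Sym2 (Fin n))) : BondConfig (Fin n))).Reachable s₀ v ↔ ω ∈ NY v := by
    intro v ω
    constructor
    · intro h
      rcases reachable_or_exists_mem_of_glue Y h with h1 | ⟨m, hm, hmv⟩
      · exact ⟨s₀, Finset.mem_coe.2 hs₀, h1⟩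
      · exact ⟨m, Finset.mem_coe.2 hm, hmv⟩
    · rintro ⟨m, hm, hmv⟩
      exact (reachable_glue_of_mem Y hs₀ (Finset.mem_coe.1 hm)).trans (reachable_glue_mono Y hmv)
  have hout : ∀ (v v' : Fin n) (ω : BondConfig (Fin n)),
      (openGraph ((ω ∪ C : Set (Sym2 (Fin n))) : BondConfig (Fin n))).Reachable v v' ↔
        ((openGraph ω).Reachable v v' ∨ (ω ∈ NY v ∧ ω ∈ NY v')) := by
    intro v v' ω
    constructor
    · intro h
      rcases reachable_or_exists_mem_of_glue Y h with h1 | ⟨m, hm, hmv'⟩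
      · exact Or.inl h1
      · rcases reachable_or_exists_mem_of_glue Y h.symm with h2 | ⟨m', hm', hm'v⟩
        · exact Or.inl h2.symm
        · exact Or.inr ⟨⟨m', Finset.mem_coe.2 hm', hm'v⟩, ⟨m, Finset.mem_coe.2 hm, hmv'⟩⟩
    · rintro (h | ⟨⟨m, hm, hmv⟩, ⟨m', hm', hm'v'⟩⟩)
      · exact reachable_glue_mono Y h
      · exact ((reachable_glue_mono Y hmv).symm.trans
          (reachable_glue_of_mem Y (Finset.mem_coe.1 hm) (Finset.mem_coe.1 hm'))).trans (reachable_glue_mono Y hm'v')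
  -- a block vertex does NOT reach `v` after gluing iff no vertex of the block reaches `v` before
  have hnot : ∀ (v : Fin n) (ω : BondConfig (Fin n)),
      ((ω ∪ C : Set (Sym2 (Fin n))) : BondConfig (Fin n)) ∈ (openConn s₀ v : Set (BondConfig (Fin n)))ᶜ ↔
        ω ∈ ({ω : BondConfig (Fin n) | ∀ m ∈ (↑Y : Set (Fin n)), ¬ (openGraph ω).Reachable m v} : Set (BondConfig (Fin n))) := by
    intro v ω
    rw [mem_compl_iff, mem_setOf_eq]
    constructor
    · intro h m hm hmv
      exact h ((hblock v ω).2 ⟨m, hm, hmv⟩)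
    · intro h hv
      obtain ⟨m, hm, hmv⟩ := (hblock v ω).1 hv
      exact h m hm hmv
  -- the three pull-backs
  simp only [Finset.set_biUnion_insert, Finset.set_biUnion_singleton] at key
  have hE1 : {ω : BondConfig (Fin n) | ((ω ∪ C : Set (Sym2 (Fin n))) : BondConfig (Fin n)) ∈
        (openConn j b : Set (BondConfig (Fin n)))} = openConn j b ∪ (NY j ∩ NY b) := by
    ext ω
    simp only [mem_setOf_eq]
    rw [mem_union, mem_inter_iff]
    exact hout j b ω
  have hE2 : {ω : BondConfig (Fin n) | ((ω ∪ C : Set (Sym2 (Fin n))) : BondConfig (Fin n)) ∈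
        (openConn s₀ b ∩ (openConn s₀ d ∪ openConn s₀ j ∪ openConn s₀ c) : Set (BondConfig (Fin n)))} =
      NY b ∩ (NY c ∪ (NY d ∪ NY j)) := by
    ext ω
    simp only [mem_setOf_eq]
    rw [mem_inter_iff, mem_inter_iff, mem_union, mem_union, mem_union, mem_union]
    rw [← hblock b ω, ← hblock c ω, ← hblock d ω, ← hblock j ω]
    constructor
    · rintro ⟨h1, (h2 | h2) | h2⟩
      · exact ⟨h1, Or.inr (Or.inl h2)⟩
      · exact ⟨h1, Or.inr (Or.inr h2)⟩
      · exact ⟨h1, Or.inl h2⟩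
    · rintro ⟨h1, h2 | h2 | h2⟩
      · exact ⟨h1, Or.inr h2⟩
      · exact ⟨h1, Or.inl (Or.inl h2)⟩
      · exact ⟨h1, Or.inl (Or.inr h2)⟩
  have hE3 : {ω : BondConfig (Fin n) | ((ω ∪ C : Set (Sym2 (Fin n))) : BondConfig (Fin n)) ∈
        (openConn c b ∩ ((openConn s₀ b)ᶜ ∩ (openConn s₀ c)ᶜ ∩ (openConn s₀ d)ᶜ ∩ (openConn s₀ j)ᶜ) : Set (BondConfig (Fin n)))} =
      openConn c b ∩ ({ω : BondConfig (Fin n) | ∀ m ∈ (↑Y : Set (Fin n)), ¬ (openGraph ω).Reachable m b} ∩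
        ({ω : BondConfig (Fin n) | ∀ m ∈ (↑Y : Set (Fin n)), ¬ (openGraph ω).Reachable m c} ∩
          ({ω : BondConfig (Fin n) | ∀ m ∈ (↑Y : Set (Fin n)), ¬ (openGraph ω).Reachable m d} ∩
            {ω : BondConfig (Fin n) | ∀ m ∈ (↑Y : Set (Fin n)), ¬ (openGraph ω).Reachable m j}))) := by
    ext ω
    simp only [mem_setOf_eq]
    rw [mem_inter_iff, mem_inter_iff, mem_inter_iff, mem_inter_iff, hnot b ω, hnot c ω, hnot d ω, hnot j ω,
      mem_inter_iff, mem_inter_iff, mem_inter_iff, mem_inter_iff]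
    constructor
    · rintro ⟨h1, ⟨⟨hb', hc'⟩, hd'⟩, hj'⟩
      refine ⟨?_, hb', hc', hd', hj'⟩
      rcases (hout c b ω).1 h1 with h | ⟨hc'', -⟩
      · exact h
      · obtain ⟨m, hm, hmc⟩ := hc''
        exact absurd hmc (hc' m hm)
    · rintro ⟨h1, hb', hc', hd', hj'⟩
      exact ⟨(hout c b ω).2 (Or.inl h1), ⟨⟨hb', hc'⟩, hd'⟩, hj'⟩
  rw [hpush, hpush, hpush, hE1, hE2, hE3]
  exact key

/-- **The regime-I exchange inequality at every atom, from rankings in the UNGLUED graph `K_u`.**  Let `K_u = (1−u)·w + u·w[cd↦1]`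
(mixture form) and suppose the witness `j` is the least `b`-reliable of `j, c, d` in `K_u`.  Then for every block `Y ∌ b, c` and every
`s₀ ∈ Y`, in the mixture `K_u/Y = (1−u)·L + u·M` (`L = glue_Y w`, `M = L[cd↦1]`):
`μ(jb) − μ(s₀b) ≤ μ((cb ∪ db), s₀ ≁ b,c,d,j) − μ(s₀b, c↮b, d↮b, (jc ∪ jd))` — the hypothesis `hexI` of
`face_regimeI_of_exchange` / `kernel_twoPlusStar_regimeI_of_exchange`, hard core included.
[cite: KozmaNitzan2024, Question 9 (p. 36), (9) (pp. 9–10), Lemma 5 (p. 13)] -/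
theorem exchangeI_of_unglued_ranking (w : Sym2 (Fin n) → unitInterval) (Y : Finset (Fin n)) (c d j b s₀ : Fin n) (u : unitInterval)
    (hs₀ : s₀ ∈ Y) (hbY : b ∉ Y) (hcY : c ∉ Y) (hcb : c ≠ b) (hdb : d ≠ b) (hjb : j ≠ b) (hcd : c ≠ d) (hcj : c ≠ j) (hdj : d ≠ j)
    (hjcu : (1 - (u : ℝ)) * (prodBernoulli w).real (openConn j b) +
        (u : ℝ) * (prodBernoulli (fun f : Sym2 (Fin n) => if f = s(c, d) then 1 else w f)).real (openConn j b) ≤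
      (1 - (u : ℝ)) * (prodBernoulli w).real (openConn c b) +
        (u : ℝ) * (prodBernoulli (fun f : Sym2 (Fin n) => if f = s(c, d) then 1 else w f)).real (openConn c b))
    (hjdu : (1 - (u : ℝ)) * (prodBernoulli w).real (openConn j b) +
        (u : ℝ) * (prodBernoulli (fun f : Sym2 (Fin n) => if f = s(c, d) then 1 else w f)).real (openConn j b) ≤
      (1 - (u : ℝ)) * (prodBernoulli w).real (openConn d b) +
        (u : ℝ) * (prodBernoulli (fun f : Sym2 (Fin n) => if f = s(c, d) then 1 else w f)).real (openConn d b)) :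
    ((1 - (u : ℝ)) * (prodBernoulli (fun e : Sym2 (Fin n) => if (∀ x ∈ e, x ∈ Y) ∧ ¬ e.IsDiag then 1 else w e)).real (openConn j b) +
          (u : ℝ) * (prodBernoulli (fun f : Sym2 (Fin n) => if f = s(c, d) then 1 else
            (if (∀ x ∈ f, x ∈ Y) ∧ ¬ f.IsDiag then 1 else w f))).real (openConn j b)) -
        ((1 - (u : ℝ)) * (prodBernoulli (fun e : Sym2 (Fin n) => if (∀ x ∈ e, x ∈ Y) ∧ ¬ e.IsDiag then 1 else w e)).real (openConn s₀ b) +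
          (u : ℝ) * (prodBernoulli (fun f : Sym2 (Fin n) => if f = s(c, d) then 1 else
            (if (∀ x ∈ f, x ∈ Y) ∧ ¬ f.IsDiag then 1 else w f))).real (openConn s₀ b)) ≤
      ((1 - (u : ℝ)) * (prodBernoulli (fun e : Sym2 (Fin n) => if (∀ x ∈ e, x ∈ Y) ∧ ¬ e.IsDiag then 1 else w e)).real
            ((openConn c b ∪ openConn d b) ∩ (openConn s₀ b)ᶜ ∩ (openConn s₀ c)ᶜ ∩ (openConn s₀ d)ᶜ ∩ (openConn s₀ j)ᶜ) +
          (u : ℝ) * (prodBernoulli (fun f : Sym2 (Fin n) => if f = s(c, d) then 1 else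
            (if (∀ x ∈ f, x ∈ Y) ∧ ¬ f.IsDiag then 1 else w f))).real
            ((openConn c b ∪ openConn d b) ∩ (openConn s₀ b)ᶜ ∩ (openConn s₀ c)ᶜ ∩ (openConn s₀ d)ᶜ ∩ (openConn s₀ j)ᶜ)) -
        ((1 - (u : ℝ)) * (prodBernoulli (fun e : Sym2 (Fin n) => if (∀ x ∈ e, x ∈ Y) ∧ ¬ e.IsDiag then 1 else w e)).real
            (openConn s₀ b ∩ (openConn c b)ᶜ ∩ (openConn d b)ᶜ ∩ (openConn j c ∪ openConn j d)) +
          (u : ℝ) * (prodBernoulli (fun f : Sym2 (Fin n) => if f = s(c, d) then 1 else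
            (if (∀ x ∈ f, x ∈ Y) ∧ ¬ f.IsDiag then 1 else w f))).real
            (openConn s₀ b ∩ (openConn c b)ᶜ ∩ (openConn d b)ᶜ ∩ (openConn j c ∪ openConn j d))) := by
  set L : Sym2 (Fin n) → unitInterval := fun e => if (∀ x ∈ e, x ∈ Y) ∧ ¬ e.IsDiag then 1 else w e with hL
  set M : Sym2 (Fin n) → unitInterval := fun f => if f = s(c, d) then 1 else L f with hM
  set R : Sym2 (Fin n) → unitInterval := fun f => if f = s(c, d) then Set.Icc.convexComb (L s(c, d)) 1 u else L f with hR
  -- the raised (unglued) graph `R₀ = K_u` and its mixture identity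
  set R₀ : Sym2 (Fin n) → unitInterval := fun f => if f = s(c, d) then Set.Icc.convexComb (w s(c, d)) 1 u else w f with hR₀
  have hmixw : ∀ X : Set (BondConfig (Fin n)), (prodBernoulli R₀).real X =
      (1 - (u : ℝ)) * (prodBernoulli w).real X +
        (u : ℝ) * (prodBernoulli (fun f : Sym2 (Fin n) => if f = s(c, d) then 1 else w f)).real X :=
    fun X => real_raisePair_eq_mix w s(c, d) u X
  have hmixL : ∀ X : Set (BondConfig (Fin n)), (prodBernoulli R).real X =
      (1 - (u : ℝ)) * (prodBernoulli L).real X + (u : ℝ) * (prodBernoulli M).real X :=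
    fun X => real_raisePair_eq_mix L s(c, d) u X
  -- rankings in `R₀`
  have hjc' : (prodBernoulli R₀).real (openConn j b) ≤ (prodBernoulli R₀).real (openConn c b) := by
    rw [hmixw, hmixw]; exact hjcu
  have hjd' : (prodBernoulli R₀).real (openConn j b) ≤ (prodBernoulli R₀).real (openConn d b) := by
    rw [hmixw, hmixw]; exact hjdu
  -- the glued CLUB row in `glue_Y R₀ = R`
  have hrow := gluedClub_row R₀ Y c d j b s₀ hs₀ hbY hcb hdb hjb hcd hcj hdj hjc' hjd'
  have hswapR : (fun e : Sym2 (Fin n) => if (∀ x ∈ e, x ∈ Y) ∧ ¬ e.IsDiag then 1 else R₀ e) = R := by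
    have h := glue_modifyPair_comm w Y (c := c) (d := d) hcY (fun t => Set.Icc.convexComb t 1 u)
    simpa only [hR₀, hR, hL] using h
  rw [hswapR] at hrow
  -- the exchange inequality in `R` (isolation-bound socket, `w = j`, port `c`), then the mixture form
  have key := spectatorExchange_of_isolationBound R b s₀ j c d j hrow
  rw [hmixL, hmixL, hmixL, hmixL] at key
  exact key

/-- **The formal face in regime I, fully anchored** (no per-atom hypothesis): `0 ≤ Σ_Y ν(Y)[(1−u) G'(Y) + u G(Y ∪ {c,d})]` from the split rows
of `c` (through `hjcu`) and `q`, for EVERY law `ν ≥ 0`, under `hle` (`c ≤ d` in `K`), `hjcu` (`j ≤ c` in `K_u`), `hqj`, `hqmin` only.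
[cite: KozmaNitzan2024, Question 9 (p. 36), Question 7 (p. 36), Lemma 5 (p. 13)] -/
theorem face_regimeI_anchored (K : Sym2 (Fin n) → unitInterval) (o c d q j b : Fin n) (Q : Finset (Fin n))
    (ν : Finset (Fin n) → ℝ) (hν : ∀ S ∈ Q.powerset, 0 ≤ ν S) (u : unitInterval)
    (hoQ : o ∉ Q) (hcQ : c ∉ Q) (hdQ : d ∉ Q) (hbQ : b ∉ Q) (hcd : c ≠ d) (hoc : o ≠ c) (hod : o ≠ d) (hjo : j ≠ o) (hbo : b ≠ o)
    (hisoK : ∀ u' : Fin n, u' ≠ o → K s(o, u') = 0)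
    (G : Finset (Fin n) → ℝ)
    (hG : ∀ T : Finset (Fin n), G T =
      (prodBernoulli (fun f : Sym2 (Fin n) => if f ∈ T.image (fun t => s(o, t)) then 1 else K f)).real (openConn o b) -
        (prodBernoulli (fun f : Sym2 (Fin n) => if f ∈ T.image (fun t => s(o, t)) then 1 else K f)).real (openConn j b))
    (hle : (prodBernoulli K).real (openConn c b) ≤ (prodBernoulli K).real (openConn d b))
    (hcb : c ≠ b) (hdb : d ≠ b) (hjb : j ≠ b) (hcj : c ≠ j) (hdj : d ≠ j) (hjQ : j ∉ Q)
    (hjcu : (1 - (u : ℝ)) * (prodBernoulli K).real (openConn j b) +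
        (u : ℝ) * (prodBernoulli (fun f : Sym2 (Fin n) => if f = s(c, d) then 1 else K f)).real (openConn j b) ≤
      (1 - (u : ℝ)) * (prodBernoulli K).real (openConn c b) +
        (u : ℝ) * (prodBernoulli (fun f : Sym2 (Fin n) => if f = s(c, d) then 1 else K f)).real (openConn c b))
    (hqj : (1 - (u : ℝ)) * (prodBernoulli K).real (openConn q b) +
        (u : ℝ) * (prodBernoulli (fun f : Sym2 (Fin n) => if f = s(c, d) then 1 else K f)).real (openConn q b) ≤
      (1 - (u : ℝ)) * (prodBernoulli K).real (openConn j b) +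
        (u : ℝ) * (prodBernoulli (fun f : Sym2 (Fin n) => if f = s(c, d) then 1 else K f)).real (openConn j b))
    (hqmin : ∀ y ∈ Q, (1 - (u : ℝ)) * (prodBernoulli K).real (openConn q b) +
        (u : ℝ) * (prodBernoulli (fun f : Sym2 (Fin n) => if f = s(c, d) then 1 else K f)).real (openConn q b) ≤
      (1 - (u : ℝ)) * (prodBernoulli K).real (openConn y b) +
        (u : ℝ) * (prodBernoulli (fun f : Sym2 (Fin n) => if f = s(c, d) then 1 else K f)).real (openConn y b))
    (hrowq : 0 ≤ ∑ S ∈ Q.powerset, ν S *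
      ((1 - (u : ℝ)) * ((prodBernoulli (fun e : Sym2 (Fin n) => if (∀ x ∈ e, x ∈ S) ∧ ¬ e.IsDiag then 1 else K e)).real (openConn q b) -
          (prodBernoulli (fun e : Sym2 (Fin n) => if (∀ x ∈ e, x ∈ S) ∧ ¬ e.IsDiag then 1 else K e)).real (openConn j b)) +
        (u : ℝ) * ((prodBernoulli (fun f : Sym2 (Fin n) => if f = s(c, d) then 1 else
              (if (∀ x ∈ f, x ∈ S) ∧ ¬ f.IsDiag then 1 else K f))).real (openConn q b) -
          (prodBernoulli (fun f : Sym2 (Fin n) => if f = s(c, d) then 1 else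
              (if (∀ x ∈ f, x ∈ S) ∧ ¬ f.IsDiag then 1 else K f))).real (openConn j b)))) :
    0 ≤ ∑ Y ∈ Q.powerset, ν Y * ((1 - (u : ℝ)) * (if Y = ∅ then 0 else G Y) + (u : ℝ) * G (insert c (insert d Y))) := by
  have hsure := real_openConn_eq_of_surePair K c d b hcd
  have hu1' : 0 ≤ 1 - (u : ℝ) := sub_nonneg.2 (unitInterval.le_one u)
  have hcdu : (1 - (u : ℝ)) * (prodBernoulli K).real (openConn c b) +
        (u : ℝ) * (prodBernoulli (fun f : Sym2 (Fin n) => if f = s(c, d) then 1 else K f)).real (openConn c b) ≤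
      (1 - (u : ℝ)) * (prodBernoulli K).real (openConn d b) +
        (u : ℝ) * (prodBernoulli (fun f : Sym2 (Fin n) => if f = s(c, d) then 1 else K f)).real (openConn d b) := by
    rw [hsure]
    nlinarith [mul_le_mul_of_nonneg_left hle hu1']
  have hjdu := hjcu.trans hcdu
  exact face_regimeI_of_exchange K o c d q j b Q ν hν u hoQ hcQ hdQ hbQ hcd hoc hod hjo hbo hisoK G hG hle hcb hdb hcj hdj hjQ hjcu
    (fun Y hY _ s₀ hs₀ =>
      exchangeI_of_unglued_ranking K Y c d j b s₀ u hs₀ (fun h => hbQ (Finset.mem_powerset.1 hY h))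
        (fun h => hcQ (Finset.mem_powerset.1 hY h)) hcb hdb hjb hcd hcj hdj hjcu hjdu)
    hqj hqmin hrowq

/-- **The `2 + (any law)` kernel in regime I, fully anchored**: the split rows of `c`, `d`, `q` give `F ≥ 0` for EVERY law `ν ≥ 0` on the
subsets of `Q`, under `hle`, `hjcu`, `hqj`, `hqmin` only.  [cite: KozmaNitzan2024, Question 9 (p. 36), Question 7 (p. 36), Lemma 5 (p. 13)] -/
theorem twoPlusLaw_regimeI_anchored (K : Sym2 (Fin n) → unitInterval) (o c d q j b : Fin n) (Q : Finset (Fin n))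
    (ν : Finset (Fin n) → ℝ) (hν : ∀ S ∈ Q.powerset, 0 ≤ ν S) (u : unitInterval) {h₁ h₂ : ℝ}
    (hh₁ : 0 < h₁) (hh₁' : h₁ ≤ 1) (hh₂ : 0 < h₂) (hh₂' : h₂ ≤ 1) (hprod : h₁ * h₂ = u) (hu1 : (u : ℝ) < 1)
    (hoQ : o ∉ Q) (hcQ : c ∉ Q) (hdQ : d ∉ Q) (hbQ : b ∉ Q) (hcd : c ≠ d) (hoc : o ≠ c) (hod : o ≠ d) (hjo : j ≠ o) (hbo : b ≠ o)
    (hisoK : ∀ u' : Fin n, u' ≠ o → K s(o, u') = 0)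
    (G : Finset (Fin n) → ℝ)
    (hG : ∀ T : Finset (Fin n), G T =
      (prodBernoulli (fun f : Sym2 (Fin n) => if f ∈ T.image (fun t => s(o, t)) then 1 else K f)).real (openConn o b) -
        (prodBernoulli (fun f : Sym2 (Fin n) => if f ∈ T.image (fun t => s(o, t)) then 1 else K f)).real (openConn j b))
    (hle : (prodBernoulli K).real (openConn c b) ≤ (prodBernoulli K).real (openConn d b))
    (hcb : c ≠ b) (hdb : d ≠ b) (hjb : j ≠ b) (hcj : c ≠ j) (hdj : d ≠ j) (hjQ : j ∉ Q)
    (hjcu : (1 - (u : ℝ)) * (prodBernoulli K).real (openConn j b) +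
        (u : ℝ) * (prodBernoulli (fun f : Sym2 (Fin n) => if f = s(c, d) then 1 else K f)).real (openConn j b) ≤
      (1 - (u : ℝ)) * (prodBernoulli K).real (openConn c b) +
        (u : ℝ) * (prodBernoulli (fun f : Sym2 (Fin n) => if f = s(c, d) then 1 else K f)).real (openConn c b))
    (hqj : (1 - (u : ℝ)) * (prodBernoulli K).real (openConn q b) +
        (u : ℝ) * (prodBernoulli (fun f : Sym2 (Fin n) => if f = s(c, d) then 1 else K f)).real (openConn q b) ≤
      (1 - (u : ℝ)) * (prodBernoulli K).real (openConn j b) +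
        (u : ℝ) * (prodBernoulli (fun f : Sym2 (Fin n) => if f = s(c, d) then 1 else K f)).real (openConn j b))
    (hqmin : ∀ y ∈ Q, (1 - (u : ℝ)) * (prodBernoulli K).real (openConn q b) +
        (u : ℝ) * (prodBernoulli (fun f : Sym2 (Fin n) => if f = s(c, d) then 1 else K f)).real (openConn q b) ≤
      (1 - (u : ℝ)) * (prodBernoulli K).real (openConn y b) +
        (u : ℝ) * (prodBernoulli (fun f : Sym2 (Fin n) => if f = s(c, d) then 1 else K f)).real (openConn y b))
    (hrowc : 0 ≤ ∑ S ∈ Q.powerset, ν S *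
      ((1 - (u : ℝ)) * ((prodBernoulli (fun e : Sym2 (Fin n) => if (∀ x ∈ e, x ∈ S) ∧ ¬ e.IsDiag then 1 else K e)).real (openConn c b) -
          (prodBernoulli (fun e : Sym2 (Fin n) => if (∀ x ∈ e, x ∈ S) ∧ ¬ e.IsDiag then 1 else K e)).real (openConn j b)) +
        (u : ℝ) * ((prodBernoulli (fun f : Sym2 (Fin n) => if f = s(c, d) then 1 else
              (if (∀ x ∈ f, x ∈ S) ∧ ¬ f.IsDiag then 1 else K f))).real (openConn c b) -
          (prodBernoulli (fun f : Sym2 (Fin n) => if f = s(c, d) then 1 else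
              (if (∀ x ∈ f, x ∈ S) ∧ ¬ f.IsDiag then 1 else K f))).real (openConn j b))))
    (hrowd : 0 ≤ ∑ S ∈ Q.powerset, ν S *
      ((1 - (u : ℝ)) * ((prodBernoulli (fun e : Sym2 (Fin n) => if (∀ x ∈ e, x ∈ S) ∧ ¬ e.IsDiag then 1 else K e)).real (openConn d b) -
          (prodBernoulli (fun e : Sym2 (Fin n) => if (∀ x ∈ e, x ∈ S) ∧ ¬ e.IsDiag then 1 else K e)).real (openConn j b)) +
        (u : ℝ) * ((prodBernoulli (fun f : Sym2 (Fin n) => if f = s(d, c) then 1 else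
              (if (∀ x ∈ f, x ∈ S) ∧ ¬ f.IsDiag then 1 else K f))).real (openConn d b) -
          (prodBernoulli (fun f : Sym2 (Fin n) => if f = s(d, c) then 1 else
              (if (∀ x ∈ f, x ∈ S) ∧ ¬ f.IsDiag then 1 else K f))).real (openConn j b))))
    (hrowq : 0 ≤ ∑ S ∈ Q.powerset, ν S *
      ((1 - (u : ℝ)) * ((prodBernoulli (fun e : Sym2 (Fin n) => if (∀ x ∈ e, x ∈ S) ∧ ¬ e.IsDiag then 1 else K e)).real (openConn q b) -
          (prodBernoulli (fun e : Sym2 (Fin n) => if (∀ x ∈ e, x ∈ S) ∧ ¬ e.IsDiag then 1 else K e)).real (openConn j b)) +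
        (u : ℝ) * ((prodBernoulli (fun f : Sym2 (Fin n) => if f = s(c, d) then 1 else
              (if (∀ x ∈ f, x ∈ S) ∧ ¬ f.IsDiag then 1 else K f))).real (openConn q b) -
          (prodBernoulli (fun f : Sym2 (Fin n) => if f = s(c, d) then 1 else
              (if (∀ x ∈ f, x ∈ S) ∧ ¬ f.IsDiag then 1 else K f))).real (openConn j b)))) :
    0 ≤ ∑ Y ∈ Q.powerset, ν Y *
        ((1 - h₁) * (1 - h₂) * (if Y = ∅ then 0 else G Y) + (1 - h₁) * h₂ * G (insert d Y) +
          h₁ * (1 - h₂) * G (insert c Y) + h₁ * h₂ * G (insert c (insert d Y))) := by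
  have hsure := real_openConn_eq_of_surePair K c d b hcd
  have hu1' : 0 ≤ 1 - (u : ℝ) := sub_nonneg.2 (unitInterval.le_one u)
  have hcdu : (1 - (u : ℝ)) * (prodBernoulli K).real (openConn c b) +
        (u : ℝ) * (prodBernoulli (fun f : Sym2 (Fin n) => if f = s(c, d) then 1 else K f)).real (openConn c b) ≤
      (1 - (u : ℝ)) * (prodBernoulli K).real (openConn d b) +
        (u : ℝ) * (prodBernoulli (fun f : Sym2 (Fin n) => if f = s(c, d) then 1 else K f)).real (openConn d b) := by
    rw [hsure]
    nlinarith [mul_le_mul_of_nonneg_left hle hu1']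
  have hjdu := hjcu.trans hcdu
  exact twoPlusLaw_regimeI_of_exchange K o c d q j b Q ν hν u hh₁ hh₁' hh₂ hh₂' hprod hu1 hoQ hcQ hdQ hbQ hcd hoc hod hjo hbo hisoK G hG
    hle hcb hdb hcj hdj hjQ hjcu
    (fun Y hY _ s₀ hs₀ =>
      exchangeI_of_unglued_ranking K Y c d j b s₀ u hs₀ (fun h => hbQ (Finset.mem_powerset.1 hY h))
        (fun h => hcQ (Finset.mem_powerset.1 hY h)) hcb hdb hjb hcd hcj hdj hjcu hjdu)
    hqj hqmin hrowc hrowd hrowq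

end UpsetExchange

end

end Summit.CriticalPhenomena.PercolationContinuityZ3.Theorems
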